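import Literature.MathematicalPhysics.QuantumFieldTheory.Balaban1983to89.B9Eq335CoverageAtLettersY

/-!
# `Balaban1983to89.B9Thm311FlippedBondLetters` — T. Bałaban, *Propagators for lattice gauge theories in a background field*, Commun. Math. Phys. **99** (1985)
# 389–434 [Balaban1985BackgroundPropagators] (3.1)–(3.10) pp. 390–392 at def-Y's letters for a `{±1}`-VALUED background flipped at ONE bond: trivial transports,
# holonomies `±1`, no commutator part, the single-bond test field, and «every plaquette through the flipped bond is frustrated» (file 1∕3 of this seat's
# «Consequence 2» set; 2∕3 = `B9Thm311FlippedBondForms`, 3∕3 = `B9Thm311FlippedBondNotPosDef`)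

statement-level skeleton of published theorems with citation tags; proofs where landed; nothing here is a claim about the Yang–Mills mass gap

PDF held: `paper:balaban1985-cmp99-background-propagators` (journal page = PDF page + 388); pp. 390–396, 416 read by this seat (2026-08-27).

THE PRINT (verbatim).  p. 416, Thm 3.11: *«Let us assume that U satisfies (3.35). Then … the operators Δ′_a, G′, (Q′G′²Q′\*)⁻¹, Δ_a, G are positive definite.»*  p. 395,
(3.26): *«Δ_a = Δ + DRD\* + Q\*aQ»*.  p. 392, (3.10): *«⟨A, ΔA⟩ = ⟨A, D\*DA⟩ + ⟨A, Δ′A⟩, ⟨A, Δ′A⟩ = Σ_p η^d tr((D¹_UA)(p))²η⁻²(Re U(∂p) − 1) + …»*.  p. 396, (3.35):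
the class of backgrounds (cube gauges on the cubes of the class of p. 396).

WHY THIS SET OF THREE FILES (cell context).  NODE 06's certificate of record derives row 17 from the pin + ONE displayed clause `hΔA` = «for every `U` in the typed
class (3.35) (`(bg9Y …).Reg335 c35Y α₀ U`), `PosDefTr 1 (deltaAY x.toKIdx (parSymY _) (parBY _) (GpY _ (parSymY _)) U)`».  This seat's LOCATED-COVERAGE-1 (bus,
dag-lead g10 DESK WORD; director-ym №175 → def-Y WAKE R289) observed that def-Y's typed cube class `cubeClass396` (level window `{j, j+1}`, `n ≤ 10`) need not cover
a bond `b₀` crossing a big-block face of a one-block-thick level slab, and file 4 (`B9Eq335CoverageAtLettersY`) PROVED that at such an UNCOVERED bond the typed class is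
blind: `U(b₀) ↦ −U(b₀)` stays in the class.  These three files compute «Consequence 2» asked for by the desk and the referees (WATCH-ΔA ∕ A4): at the configuration
`U₁ = 1` flipped to `−1` at `b₀`, the single-bond test field `A = E·δ_{b₀}` has `⟨A, Δ_a(U₁)A⟩₁ ≤ (2 − d + 2b₁L^{−(d+3)})·c_f²·HS(E) < 0` (dimension `d+1 = 4`), so
`Δ_a(U₁)` is NOT positive definite although `U₁` is in the typed class — hence the clause body of `hΔA` is FALSE at any member with an uncovered bond.  WHETHER such a
member exists (a `TDomains` with the slab geometry inhabiting `MemberY`, `L ≥ 19`) is NOT decided here: the result is the `¬`-side MODULO that existence, and at the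
same time the settled negative that makes def-Y's class repair (r1)∕(r2)∕(r3) load-bearing.

WHAT IS PROVED HERE (sorry-free; 0 `def`; nothing of [B9] asserted).
* §1 for `U` with values in `Subgroup.zpowers (−1)` (`{±1}`): `R_eq_self_of_mem` (the adjoint action of `±1` is trivial), `holY_mem`, `holY_inv_eq`, `imHolY_eq_zero`,
  `reHolY_eq` (`Re U(∂p) = U(∂p)`), `mem_unitary_of_mem`, ★ `trIP_curv2Y_eq_zero` (`⟨A, Δ′₂(U)A⟩₁ = 0`, from file 1's bound), `curlT_mem`, `gradT_mem`.
* §2 the test field `A = E·δ_{b₀}`: ★ `curlY_single` (`(D_UA)(p) = ∂(p, b₀)·E`), ★ `divY_single` (`(D\*_UA)(z) = ∂\*(z, b₀)·E`), ★ `QY_single`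
  (`(Q(U)A)(ι) = Q(ι, b₀)·E`, def-Y's `parBY_mem`), `hs_real_smul`.
* §3 the flip at one bond (`U μ₀ x₀ = −1`, `U = 1` off `b₀`): `curlK_eq_of_edge` (tree `toMatrix'_dcE`), `mem_of_flipped`, `apply_flipped`, ★★
  `holY_eq_neg_one_of_curlK_ne_zero` (`∂(p, b₀) ≠ 0 ⇒ U(∂p) = −1`: exactly one contour bond of `p` is `b₀` — tree `dcE_ne_zero_cases` + `shift_ne_self`).
MODEL ∕ DECLARED READINGS.  def-Y's letters at a k-level index `i`, fibre `M_N(ℂ)` (L²-operator norm), `trIP` of `B9Thm311ReadingCoords`; the flipped configuration is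
presented by the two hypotheses `hb₀ : U μ₀ x₀ = −1`, `hoff : ∀ μ x, ¬(μ = μ₀ ∧ x = x₀) → U μ x = 1` (instantiated in file 3∕3 by `Function.update 1 …`).
HONEST SCOPE.  Finite lattice algebra; count-neutral; NOT a node discharge; nothing continuum ∕ OS ∕ mass gap ∕ Clay.  Cell `pub-ymgap` (HUMAN RULING D-0062), Track A node
N06 [B9], seat `pub-ymgap-dag-n06-j` (bundle F5 rows 15–17; harness re-seat gen 11), 2026-08-27; dag-lead g10 INTENT-4 DEDUP.  NEW file; nothing landed is modified.
Net new unproved facts: 0.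
-/

noncomputable section

namespace Literature.MathematicalPhysics.QuantumFieldTheory.Balaban1983to89.B9Thm311FlippedBondLetters

open Literature.MathematicalPhysics.QuantumFieldTheory.Balaban1983to89
open B9Thm311ReadingCoords B9Thm311AdjointAtLetters B9Thm311DeltaPrimeSymm B9Thm311DeltaPrimePos B9Thm311AdjointPairs B9Thm311Curv2Symm
  B9Thm311ProjectionR B9Ineq349SiteAdjoint B9Ineq369CurvatureSmallAtLettersY B9Thm311PosOfPrincipalAtLettersY B9Eq335PlaquetteAtLettersY
  B9Eq335CoverageAtLettersY Node00
open B6KLevelCensusIndexV1 B9BackgroundsKLevelV1 B6GlobalChartV1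
open scoped Matrix

/-! ## §1 `{±1}`-valued configurations: trivial transports, holonomies `±1`, no commutator part -/

section Sign

open scoped Matrix.Norms.L2Operator

variable {d ℓ : ℕ} {hd : 1 ≤ d + 1} {hL : Odd (ℓ + 1) ∧ 1 < ℓ + 1} {b₀ b₁ : ℝ} {N : ℕ}
variable (i : KIdx d ℓ hd hL b₀ b₁)

/-- the elements of the subgroup generated by `−1` are `±1`. [folklore] -/
private theorem sign_of_mem {V : (Matrix (Fin N) (Fin N) ℂ)ˣ} (hV : V ∈ Subgroup.zpowers (-1 : (Matrix (Fin N) (Fin N) ℂ)ˣ)) : V = 1 ∨ V = -1 := by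
  obtain ⟨k, rfl⟩ := Subgroup.mem_zpowers_iff.1 hV
  rcases Int.eq_nat_or_neg k with ⟨n, rfl | rfl⟩
  · rw [zpow_natCast]; exact neg_one_pow_eq_or _ n
  · rw [zpow_neg, zpow_natCast]
    rcases neg_one_pow_eq_or ((Matrix (Fin N) (Fin N) ℂ)ˣ) n with h | h <;> rw [h]
    · exact Or.inl inv_one
    · exact Or.inr (by rw [inv_neg, inv_one])

/-- `−1` generates. [folklore] -/
private theorem neg_one_mem : (-1 : (Matrix (Fin N) (Fin N) ℂ)ˣ) ∈ Subgroup.zpowers (-1 : (Matrix (Fin N) (Fin N) ℂ)ˣ) :=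
  Subgroup.mem_zpowers _

/-- the adjoint action of `±1` is trivial. [cite: Balaban1985BackgroundPropagators, (3.1) p.390 (R(U)X = UXU⁻¹), bookkeeping] -/
theorem R_eq_self_of_mem {V : (Matrix (Fin N) (Fin N) ℂ)ˣ} (hV : V ∈ Subgroup.zpowers (-1 : (Matrix (Fin N) (Fin N) ℂ)ˣ)) (X : Matrix (Fin N) (Fin N) ℂ) :
    B9Eq39Adjoint.R V X = X := by
  rcases sign_of_mem hV with rfl | rfl
  · exact B9Eq39Adjoint.R_one X
  · unfold B9Eq39Adjoint.R
    rw [inv_neg, inv_one, Units.val_neg, Units.val_one, neg_mul, one_mul, mul_neg, mul_one, neg_neg]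

variable {U : CfgY (Matrix (Fin N) (Fin N) ℂ) i} (hU : ∀ μ x, U μ x ∈ Subgroup.zpowers (-1 : (Matrix (Fin N) (Fin N) ℂ)ˣ))
include hU

/-- the plaquette holonomy of a `{±1}`-valued configuration is `±1`. [cite: Balaban1985BackgroundPropagators, (3.1) p.390, bookkeeping] -/
theorem holY_mem (p : PlaqY i) : holY i U p ∈ Subgroup.zpowers (-1 : (Matrix (Fin N) (Fin N) ℂ)ˣ) := by
  unfold holY
  exact Subgroup.mul_mem _ (Subgroup.mul_mem _ (Subgroup.mul_mem _ (hU _ _) (hU _ _)) (Subgroup.inv_mem _ (hU _ _)))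
    (Subgroup.inv_mem _ (hU _ _))

/-- … so `U(∂p)⁻¹ = U(∂p)`. [cite: Balaban1985BackgroundPropagators, (3.5) p.391, bookkeeping] -/
theorem holY_inv_eq (p : PlaqY i) : (holY i U p)⁻¹ = holY i U p := by
  rcases sign_of_mem (holY_mem i hU p) with h | h <;> rw [h] <;> simp

/-- … `Im U(∂p) = 0`. [cite: Balaban1985BackgroundPropagators, (3.7) p.391, bookkeeping] -/
theorem imHolY_eq_zero (p : PlaqY i) : imHolY i U p = 0 := by
  unfold imHolY
  rw [holY_inv_eq i hU p, sub_self, smul_zero]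

/-- … and `Re U(∂p) = U(∂p)`. [cite: Balaban1985BackgroundPropagators, (3.7) p.391, bookkeeping] -/
theorem reHolY_eq (p : PlaqY i) : reHolY i U p = ((holY i U p : (Matrix (Fin N) (Fin N) ℂ)ˣ) : Matrix (Fin N) (Fin N) ℂ) := by
  unfold reHolY
  rw [holY_inv_eq i hU p, ← two_smul ℂ, smul_smul]
  norm_num

/-- a `{±1}`-valued configuration is unitary-valued. [cite: Balaban1985BackgroundPropagators, (3.35) p.396 (U ∈ G ⊂ U(N)), bookkeeping] -/
theorem mem_unitary_of_mem (μ : Fin (PV d ℓ i.m i.K hd hL).d) (x : Site (PV d ℓ i.m i.K hd hL) 0) :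
    ((U μ x : (Matrix (Fin N) (Fin N) ℂ)ˣ) : Matrix (Fin N) (Fin N) ℂ) ∈ unitary (Matrix (Fin N) (Fin N) ℂ) := by
  rcases sign_of_mem (hU μ x) with h | h <;> rw [h]
  · rw [Units.val_one]; exact (unitary _).one_mem
  · rw [Units.val_neg, Units.val_one]
    exact Unitary.mem_iff.2 ⟨by rw [star_neg, star_one, neg_mul_neg, one_mul], by rw [star_neg, star_one, neg_mul_neg, one_mul]⟩

/-- the commutator part of the Hessian VANISHES at a `{±1}`-valued configuration (file 1's bound with `Im U(∂p) = 0`).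
[cite: Balaban1985BackgroundPropagators, (3.10) p.392] -/
theorem trIP_curv2Y_eq_zero (A : FBondY i → Matrix (Fin N) (Fin N) ℂ) : trIP (fun _ => (1 : ℝ)) A (curv2Y i U A) = 0 := by
  have h := abs_trIP_curv2Y_le i U (mem_unitary_of_mem i hU) A
  simp only [imHolY_eq_zero i hU, smul_zero, norm_zero, zero_mul, Finset.sum_const_zero, mul_zero] at h
  exact abs_nonpos_iff.1 h

/-- the curl transporters of a `{±1}`-valued configuration are `±1`. [cite: Balaban1985BackgroundPropagators, (3.4) p.391, bookkeeping] -/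
theorem curlT_mem (p : PlaqY i) (b : FBondY i) : curlT i U p b ∈ Subgroup.zpowers (-1 : (Matrix (Fin N) (Fin N) ℂ)ˣ) := by
  unfold curlT
  split_ifs
  · exact hU _ _
  · exact hU _ _
  · exact Subgroup.one_mem _

/-- the gradient transporters of a `{±1}`-valued configuration are `±1`. [cite: Balaban1985BackgroundPropagators, (3.3) p.390, bookkeeping] -/
theorem gradT_mem (b : FBondY i) (z : SiteY i) : gradT i U b z ∈ Subgroup.zpowers (-1 : (Matrix (Fin N) (Fin N) ℂ)ˣ) := by
  unfold gradT
  split_ifs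
  · exact hU _ _
  · exact Subgroup.one_mem _

end Sign

/-! ## §2 The single-bond test field `A = E·δ_{b₀}`: its curl, divergence and averages at a `{±1}`-valued configuration -/

section SingleBond

open scoped Matrix.Norms.L2Operator

variable {d ℓ : ℕ} {hd : 1 ≤ d + 1} {hL : Odd (ℓ + 1) ∧ 1 < ℓ + 1} {b₀ b₁ : ℝ} {N : ℕ}
variable (i : KIdx d ℓ hd hL b₀ b₁) {U : CfgY (Matrix (Fin N) (Fin N) ℂ) i}
  (hU : ∀ μ x, U μ x ∈ Subgroup.zpowers (-1 : (Matrix (Fin N) (Fin N) ℂ)ˣ))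
include hU

/-- the covariant curl of `E·δ_{b₀}` at a `{±1}`-valued configuration: `(D_UA)(p) = ∂(p, b₀)·E` (flat curl kernel, trivial transport).
[cite: Balaban1985BackgroundPropagators, (3.4) p.391] -/
theorem curlY_single (b₀ : FBondY i) (E : Matrix (Fin N) (Fin N) ℂ) (p : PlaqY i) :
    curlY i U (Pi.single b₀ E) p = ((curlK i p b₀ : ℝ) : ℂ) • E := by
  rw [curlY, trLiftY_apply, Finset.sum_eq_single b₀]
  · rw [Pi.single_eq_same, R_eq_self_of_mem (curlT_mem i hU p b₀)]
  · intro b _ hb; rw [Pi.single_eq_of_ne hb, B9Eq39Adjoint.R_zero, smul_zero]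
  · intro h; exact absurd (Finset.mem_univ b₀) h

/-- the covariant divergence of `E·δ_{b₀}` at a `{±1}`-valued configuration: `(D*_UA)(z) = ∂*(z, b₀)·E`.
[cite: Balaban1985BackgroundPropagators, (3.8) p.392] -/
theorem divY_single (b₀ : FBondY i) (E : Matrix (Fin N) (Fin N) ℂ) (z : SiteY i) :
    divY i U (Pi.single b₀ E) z = ((divK i z b₀ : ℝ) : ℂ) • E := by
  rw [divY, trLiftY_apply, Finset.sum_eq_single b₀]
  · rw [Pi.single_eq_same, R_eq_self_of_mem (Subgroup.inv_mem _ (gradT_mem i hU b₀ z))]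
  · intro b _ hb; rw [Pi.single_eq_of_ne hb, B9Eq39Adjoint.R_zero, smul_zero]
  · intro h; exact absurd (Finset.mem_univ b₀) h

/-- the covariant average `Q(U)` (def-Y's taxicab `parBY`) of `E·δ_{b₀}` at a `{±1}`-valued configuration: `(Q(U)A)(ι) = Q(ι, b₀)·E`.
[cite: Balaban1985BackgroundPropagators, (3.12)–(3.14) p.393] -/
theorem QY_single (b₀ : FBondY i) (E : Matrix (Fin N) (Fin N) ℂ) (ι : IBondY i) :
    QY i (parBY i) U (Pi.single b₀ E) ι = ((qK i ι b₀ : ℝ) : ℂ) • E := by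
  rw [QY, trLiftY_apply, Finset.sum_eq_single b₀]
  · rw [Pi.single_eq_same, R_eq_self_of_mem]
    exact parBY_mem i hU _ _
  · intro b _ hb; rw [Pi.single_eq_of_ne hb, B9Eq39Adjoint.R_zero, smul_zero]
  · intro h; exact absurd (Finset.mem_univ b₀) h

omit hU in
/-- HS of a real multiple: `HS(c•E) = c²·HS(E)`. [cite: Balaban1985Averaging, (17) p.20, bookkeeping] -/
theorem hs_real_smul (c : ℝ) (E : Matrix (Fin N) (Fin N) ℂ) : ∑ a, ∑ b, ‖(((c : ℝ) : ℂ) • E) a b‖ ^ 2 = c ^ 2 * ∑ a, ∑ b, ‖E a b‖ ^ 2 := by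
  rw [hs_smul, Complex.norm_real, Real.norm_eq_abs, sq_abs]

end SingleBond

/-! ## §3 The configuration flipped at ONE bond `b₀`: every plaquette through `b₀` is frustrated -/

section Flipped

open scoped Matrix.Norms.L2Operator

variable {d ℓ : ℕ} {hd : 1 ≤ d + 1} {hL : Odd (ℓ + 1) ∧ 1 < ℓ + 1} {b₀ b₁ : ℝ} {N : ℕ}
variable (i : KIdx d ℓ hd hL b₀ b₁)

/-- the four contour bonds of a plaquette are distinct AS BONDS in the way needed: `⟨x+e_ν, μ⟩ ≠ ⟨x, μ⟩` and `⟨x+e_μ, ν⟩ ≠ ⟨x, ν⟩` (torus period ≥ 2), the others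
differ in direction. [cite: Balaban1985BackgroundPropagators, (3.2) p.390, bookkeeping] -/
theorem curlK_eq_of_edge (p : PlaqY i) (b : FBondY i) :
    curlK i p b = i.cf * ((if (⟨p.src, p.μ⟩ : FBondY i) = b then 1 else 0) + (if (⟨p.src.shift p.μ, p.ν⟩ : FBondY i) = b then 1 else 0)
      - (if (⟨p.src.shift p.ν, p.μ⟩ : FBondY i) = b then 1 else 0) - (if (⟨p.src, p.ν⟩ : FBondY i) = b then 1 else 0)) :=
  B6AgreeLapV1Chart.toMatrix'_dcE _ _ p b

variable {U : CfgY (Matrix (Fin N) (Fin N) ℂ) i} {μ₀ : Fin (PV d ℓ i.m i.K hd hL).d} {x₀ : Site (PV d ℓ i.m i.K hd hL) 0}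
  (hb₀ : U μ₀ x₀ = -1) (hoff : ∀ μ x, ¬ (μ = μ₀ ∧ x = x₀) → U μ x = 1)
include hb₀ hoff

/-- such a configuration is `{±1}`-valued. [cite: Balaban1985BackgroundPropagators, (3.35) p.396, bookkeeping] -/
theorem mem_of_flipped (μ : Fin (PV d ℓ i.m i.K hd hL).d) (x : Site (PV d ℓ i.m i.K hd hL) 0) :
    U μ x ∈ Subgroup.zpowers (-1 : (Matrix (Fin N) (Fin N) ℂ)ˣ) := by
  by_cases h : μ = μ₀ ∧ x = x₀
  · obtain ⟨rfl, rfl⟩ := h; rw [hb₀]; exact Subgroup.mem_zpowers _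
  · rw [hoff μ x h]; exact Subgroup.one_mem _

/-- the value of the flipped configuration on a bond: `−1` on `b₀`, `1` elsewhere. [cite: Balaban1985BackgroundPropagators, (3.35) p.396, bookkeeping] -/
theorem apply_flipped (μ : Fin (PV d ℓ i.m i.K hd hL).d) (x : Site (PV d ℓ i.m i.K hd hL) 0) :
    U μ x = if (⟨x, μ⟩ : FBondY i) = ⟨x₀, μ₀⟩ then -1 else 1 := by
  by_cases h : μ = μ₀ ∧ x = x₀
  · obtain ⟨rfl, rfl⟩ := h; rw [hb₀, if_pos rfl]
  · rw [hoff μ x h, if_neg]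
    intro e
    simp only [PBond.mk.injEq] at e
    exact h ⟨e.2, e.1⟩

/-- ★ **EVERY PLAQUETTE THROUGH `b₀` IS FRUSTRATED**: if `∂(p, b₀) ≠ 0` then `U(∂p) = −1` (exactly one contour bond of `p` is `b₀`, the others carry `1`).
[cite: Balaban1985BackgroundPropagators, (3.1) p.390, (3.10) p.392] -/
theorem holY_eq_neg_one_of_curlK_ne_zero (p : PlaqY i) (h : curlK i p ⟨x₀, μ₀⟩ ≠ 0) : holY i U p = -1 := by
  have hμν : p.μ ≠ p.ν := ne_of_lt p.hμν
  have hs1 : p.src.shift p.ν ≠ p.src := shift_ne_self i p.src p.ν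
  have hs2 : p.src.shift p.μ ≠ p.src := shift_ne_self i p.src p.μ
  unfold holY
  rw [apply_flipped i hb₀ hoff p.μ p.src, apply_flipped i hb₀ hoff p.ν (p.src.shift p.μ), apply_flipped i hb₀ hoff p.μ (p.src.shift p.ν),
    apply_flipped i hb₀ hoff p.ν p.src]
  rcases B6AgreeLapV1Chart.dcE_ne_zero_cases h with e | e | e | e <;> simp only [PBond.mk.injEq] at e <;> obtain ⟨e1, e2⟩ := e <;> subst e1 <;> subst e2
  · -- `b₀ = ⟨x, μ⟩`
    rw [if_pos rfl, if_neg, if_neg, if_neg] <;> simp [PBond.mk.injEq, hμν.symm, hs1]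
  · -- `b₀ = ⟨x+e_μ, ν⟩`
    rw [if_neg, if_pos rfl, if_neg, if_neg] <;> simp [PBond.mk.injEq, hμν, hs2.symm]
  · -- `b₀ = ⟨x+e_ν, μ⟩`
    rw [if_neg, if_neg, if_pos rfl, if_neg] <;> simp [PBond.mk.injEq, hμν.symm, hs1.symm]
  · -- `b₀ = ⟨x, ν⟩`
    rw [if_neg, if_neg, if_neg, if_pos rfl] <;> simp [PBond.mk.injEq, hμν, hs2]

end Flipped

end Literature.MathematicalPhysics.QuantumFieldTheory.Balaban1983to89.B9Thm311FlippedBondLetters
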